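import Literature.NumberTheory.LFunctions.ThetaChainFreeCheck
import HarnessLib

/-!
# Schoenfeld's `θ`-bound on `[599, 10⁸]` by kernel computation: data-free run, chunk 12 of 35

Topic: `Literature/NumberTheory/LFunctions`. Pure proof file (a kernel computation; nothing is
asserted, no definition). The theorems below evaluate `ThetaChain.runFree` — together `150000`
data-free steps of the certified `θ`-chain (`ThetaChain.stepFree`, `ThetaChainFreeCheck.lean`: the
next prime found and certified by two gcds with the primorials of the odd primes `≤ 2999` and in
`(2999, 10007]`, the enclosures of `log p` and `θ(p)`, and the two comparisons behind
`|θ(x) − x| ≤ √x log² x/(8π)`) — from the state at the prime `36715453` to the state at the prime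
`39329317`. Soundness: `ThetaChain.runFree_sound`; assembly of the 35 chunks: `ThetaUpTo1e8.lean`.
The expected states were obtained by evaluating a twin of the same function outside the kernel
(validated bit-for-bit on the tree's chunk `ThetaChainRun.xrun14`). Declarations of `5·10⁴` steps
(about `70 s` of kernel time each; the kernel's evaluation is linear within a declaration of this size),
`decide +kernel`, standard axioms only (`maxHeartbeats 0` lifts the deterministic time-out).

## References

* L. Schoenfeld, *Sharper bounds for the Chebyshev functions θ(x) and ψ(x). II*, Math. Comp. 30
  (1976), 337–360, Thm. 10 (6.3). [Schoenfeld1976]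
* J. B. Rosser, L. Schoenfeld, *Approximate formulas for some functions of prime numbers*,
  Illinois J. Math. 6 (1962), 64–94, Thms. 18–19 (`θ`-tables to `10⁸`). [RosserSchoenfeld1962]
-/

namespace Literature.NumberTheory.LFunctions.ThetaChainRun

open ThetaChain

set_option maxHeartbeats 0 in
/-- **Data-free certified `θ`-run, chunk 12a** (steps `1650001`–`1700000` after `8886113`: 50000 primes,
`36715453` to `37587241`). [cite: Schoenfeld1976, Thm. 10 (6.3)] -/
theorem frun12a :
    runFree 50000
      ⟨36715453, 21057926192577730370727307, 21057926192578206023442154, 44375376777138817190703379095784, 44375376777139885142538579438983⟩ =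
    some ⟨37587241, 21086295968461424803813735, 21086295968461900457488162, 45428984856239884215221508372023, 45428984856240975949716446243492⟩ := by
  decide +kernel

set_option maxHeartbeats 0 in
/-- **Data-free certified `θ`-run, chunk 12b** (steps `1700001`–`1750000` after `8886113`: 50000 primes,
`37587241` to `38458127`). [cite: Schoenfeld1976, Thm. 10 (6.3)] -/
theorem frun12b :
    runFree 50000
      ⟨37587241, 21086295968461424803813735, 21086295968461900457488162, 45428984856239884215221508372023, 45428984856240975949716446243492⟩ =
    some ⟨38458127, 21113986875352700251643007, 21113986875353175906276639, 46483994896471666063246453895737, 46483994896472781580449092385591⟩ := by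
  decide +kernel

set_option maxHeartbeats 0 in
/-- **Data-free certified `θ`-run, chunk 12c** (steps `1750001`–`1800000` after `8886113`: 50000 primes,
`38458127` to `39329317`). [cite: Schoenfeld1976, Thm. 10 (6.3)] -/
theorem frun12c :
    runFree 50000
      ⟨38458127, 21113986875352700251643007, 21113986875353175906276639, 46483994896471666063246453895737, 46483994896472781580449092385591⟩ =
    some ⟨39329317, 21141067032996354519631816, 21141067032996830175224003, 47540374929015846788937837544577, 47540374929016986088896127024066⟩ := by
  decide +kernel

end Literature.NumberTheory.LFunctions.ThetaChainRun
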